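import Summits.QuantumFields.GaugeBoot.FrameLinkRPLayerNet
import Summits.QuantumFields.GaugeBoot.BaryonStarObservable
import Summits.QuantumFields.GaugeBoot.CubicTorusLinkRPNegativeBeta
import HarnessLib

/-!
# `SU(N)` link reflection positivity FAILS on the even cubic torus at every `β < 0` for `N` odd, `3 ≤ N ≤ 2d - 3` (gauge-boot, L3 negative supplement; SU(N odd) link reflection at `β < 0`, part 6)

HONEST FRAMING (cell `pub-gaugeboot`, page 1 of every file): the venture produces certified bounds
on lattice expectations at stated coupling, gauge group, dimension and torus size; NOT a mass gap,
NOT a continuum limit, NOT a string tension; NOT Yang–Mills-summit-bearing (barriers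
`FixedCouplingUltralocality`, `PerturbativeInvisibility`). This module is a NEGATIVE structural
result about which reflection-positivity blocks a torus bootstrap may use at negative coupling; it
bounds no expectation and no certificate of the cell sits at `β < 0`.

`CubicTorusLinkRPNegativeBeta.lean` settled `SU(3)` (`d ≥ 3`). HERE the baryon star
(`BaryonStarObservable.lean`) and the layer-network theorem (`FrameLinkRPLayerNet.lean`) give, on
ANY periodic lattice with a site frame (`IsSiteFrame.linkRP_star_neg_of_neg`) and then on the even
torus `(ℤ/2Q)^d` (`Site d (2Q)`, `cubicUnit`), `Q ≥ 2`:

* `starLink_injective_cubicTorus` — the `6n+1` star links along `l` across distinct axes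
  `μ_0, …, μ_{n-1} ≠ l` are distinct;
* **`cubicTorus_linkRP_detOne_neg_odd`** — axes `k` (the reflected one), `l ≠ k` and `n` further
  distinct axes `μ_j ∉ {k, l}`; `G` compact second countable; `ρ : G → M_N(ℂ)` continuous with
  `det ρ ≡ 1`, scalar commutant, `ρ ≢ 1` and `N = 2n+1` (a bijection `Fin N ≃ Option (Fin n × Bool)`);
  EVERY `β < 0`: a bounded measurable observable `F` of the closed half `{1 ≤ x_k ≤ Q}` with
  `∫ conj F(ΘU) · F(U) dμ_β(U) < 0`, `μ_β = wilsonMeasure ρ β`, `Θ` the reflection in `x_k = ½`;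
* **`cubicTorus_linkRP_suN_neg_odd`** / **`not_cubicTorus_linkRP_suN_odd`** — the same for `SU(N)`
  lattice Yang–Mills in the fundamental representation (`N = 2n+1 ≥ 3`): the statement of
  `cubicTorus_linkRP_suN` with `0 ≤ β` replaced by any `β < 0` is FALSE;
* **`cubicTorus_linkRP_suN_odd_iff`** — with such axes available, closed-half link reflection
  positivity of `SU(2n+1)` along `k` holds for all bounded measurable half observables IFF `0 ≤ β`.

So on the even torus the link family of an `SU(N)` bootstrap is confined to `β ≥ 0` EXACTLY for
every odd `N ≤ 2d - 3` (`d = 4`: `SU(3)`, `SU(5)`), in contrast with `SU(2)`, `SU(2n)`, `U(N)`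
(every real `β`, `CubicTorusLinkRPAnyBeta.lean`) and with two dimensions (every `β`, every `G`,
`CubicTorusLinkRPTwoDim.lean`). Odd `N > 2d - 3` is NOT treated: a spin network of single
fundamental links with a vertex of valence `N` needs `N ≤ 2(d-1)` slice edges at a site; beyond that
higher representations on doubled links enter and the sign is a different question.

References: K. Osterwalder, E. Seiler, Ann. Phys. 110 (1978) 440, §2; E. Seiler, LNP 159 (1982)
Ch. 2; M. Creutz, Quarks, Gluons and Lattices (1983) Ch. 8; V. Kazakov, Z. Zheng,
arXiv:2203.11360 §3.1 (link reflections of the torus bootstrap).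
-/

noncomputable section

open MeasureTheory Complex
open scoped ComplexOrder ComplexConjugate
open Literature.MathematicalPhysics.QuantumFieldTheory (Site GaugeConfig wilsonMeasure)
open Literature.MathematicalPhysics.QuantumLattice (fundamentalRep continuous_fundamentalRep)

namespace Summit.QuantumFields.GaugeBoot

namespace TiltedRP

open Baryon LayerNet

/-! ## The baryon star in a site frame -/

section Frame

variable {A : Type*} [AddCommGroup A] {d n N : ℕ}

/-- Lowering the star by `e_k` is the star at the lowered base point. [folklore] -/
theorem lowerLink_starLink (e : Fin d → A) (k : Fin d) (x : A) (l : Fin d) (μ : Fin n → Fin d) :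
    lowerLink e k (starLink e x l μ) = starLink e (x - e k) l μ := by
  funext s
  rw [lowerLink_apply, starLink_sub]

variable {e : Fin d → A} {k : Fin d} {σ : A →+ A} {Q : ℕ} {h : A →+ ZMod (2 * Q)}

/-- The star links of the layer `1` (directions `l, μ_j ≠ k`) have height `1`. [folklore] -/
theorem IsSiteFrame.val_height_starLink (hF : IsSiteFrame e k σ Q h) {x₁ : A} (hx₁ : (h x₁).val = 1)
    {l : Fin d} (hl : l ≠ k) {μ : Fin n → Fin d} (hμk : ∀ j, μ j ≠ k) (s : StarSlot n) :
    (h (starLink e x₁ l μ s).1).val = 1 := by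
  rw [map_starLink_fst h e x₁ (hF.height_other l hl) (fun j => hF.height_other _ (hμk j)) s]
  exact hx₁

variable [Fintype A] [DecidableEq A]
variable {G : Type*} [Group G] [TopologicalSpace G] [IsTopologicalGroup G] [CompactSpace G]
  [MeasurableSpace G] [BorelSpace G] [SecondCountableTopology G]

/-- **Link RP fails at every `β < 0` against the baryon star (any periodic lattice with a site
frame).** `ρ : G → M_N(ℂ)` continuous, `det ρ ≡ 1`, scalar commutant, `ρ ≢ 1`, `N = 2n+1` via
`φ : Fin N ≃ Option (Fin n × Bool)`; a site `x₁` of height `1`, directions `l ≠ k` and `μ_j ≠ k`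
with the `6n+1` star links distinct. Then the star witness has `∫ conj F(ΘU) F(U) dμ_β < 0`. -/
theorem IsSiteFrame.linkRP_star_neg_of_neg (hF : IsSiteFrame e k σ Q h)
    (ρ : G →* Matrix (Fin N) (Fin N) ℂ) (hρ : Continuous ρ) (hirr : TwistedSlab.HasScalarCommutant ρ)
    (hρ1 : ∃ g, ρ g ≠ 1) (hdet : ∀ g, (ρ g).det = 1) {x₁ : A} (hx₁ : (h x₁).val = 1) {l : Fin d}
    (hl : l ≠ k) {μ : Fin n → Fin d} (hμk : ∀ j, μ j ≠ k) (φ : Fin N ≃ Option (Fin n × Bool))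
    (hinj : Function.Injective (starLink e x₁ l μ)) {β : ℝ} (hβ : β < 0) :
    ∫ U, conj (netWitness ρ e k Q h β (starLink e x₁ l μ) (starVal ρ φ) (configMidReflect e k σ U)) *
        netWitness ρ e k Q h β (starLink e x₁ l μ) (starVal ρ φ) U ∂(gibbs ρ e β) < 0 := by
  refine hF.linkRP_integral_conj_mul_net_neg_of_neg ρ hρ hirr hρ1 hdet hinj
    (hF.val_height_starLink hx₁ hl hμk) (starLink_snd_ne e x₁ hl hμk) (isEntryExpansion_starVal ρ φ)
    ?_ (starVal_one_ne_zero ρ φ) (odd_card_starSlot n) hβ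
  rw [lowerLink_starLink]
  exact isGaugeInvariant_starVal ρ e _ l μ φ

/-- **Corollary (any site frame): link RP in the shape of `IsSiteFrame.linkRP_integral_conj_mul_nonneg`
is FALSE at every `β < 0`** when the layer `1` carries a baryon star with distinct links. -/
theorem IsSiteFrame.not_linkRP_of_neg_of_star (hF : IsSiteFrame e k σ Q h)
    (ρ : G →* Matrix (Fin N) (Fin N) ℂ) (hρ : Continuous ρ) (hirr : TwistedSlab.HasScalarCommutant ρ)
    (hρ1 : ∃ g, ρ g ≠ 1) (hdet : ∀ g, (ρ g).det = 1) {x₁ : A} (hx₁ : (h x₁).val = 1) {l : Fin d}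
    (hl : l ≠ k) {μ : Fin n → Fin d} (hμk : ∀ j, μ j ≠ k) (φ : Fin N ≃ Option (Fin n × Bool))
    (hinj : Function.Injective (starLink e x₁ l μ)) {β : ℝ} (hβ : β < 0) :
    ¬ ∀ F : Config A d G → ℂ, Measurable F → (∃ C : ℝ, ∀ U, ‖F U‖ ≤ C) →
        IsMidObservable e Q h F →
        0 ≤ ∫ U, conj (F (configMidReflect e k σ U)) * F U ∂(gibbs ρ e β) := by
  refine hF.not_linkRP_of_neg_of_oddNet ρ hρ hirr hρ1 hdet hinj
    (hF.val_height_starLink hx₁ hl hμk) (starLink_snd_ne e x₁ hl hμk) (isEntryExpansion_starVal ρ φ)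
    ?_ (starVal_one_ne_zero ρ φ) (odd_card_starSlot n) hβ
  rw [lowerLink_starLink]
  exact isGaugeInvariant_starVal ρ e _ l μ φ

end Frame

/-! ## The even cubic torus -/

section Torus

variable {d n Q N : ℕ} [NeZero Q]

omit [NeZero Q] in
/-- **On the even cubic torus `(ℤ/2Q)^d`, `Q ≥ 2`, the star links along `l` across distinct axes
`μ_j ≠ l` are distinct.** [folklore] -/
theorem starLink_injective_cubicTorus (hQ : 2 ≤ Q) (x : Site d (2 * Q)) {l : Fin d}
    {μ : Fin n → Fin d} (hμ : Function.Injective μ) (hμl : ∀ j, μ j ≠ l) :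
    Function.Injective (starLink (cubicUnit d (2 * Q)) x l μ) := by
  haveI : Fact (1 < 2 * Q) := ⟨by omega⟩
  have h1 : (1 : ZMod (2 * Q)) ≠ 0 := one_ne_zero
  have h2 : (1 : ZMod (2 * Q)) + 1 ≠ 0 := by
    rw [show (1 : ZMod (2 * Q)) + 1 = ((2 : ℕ) : ZMod (2 * Q)) by norm_num,
      Ne, ZMod.natCast_eq_zero_iff]
    intro h
    have := Nat.le_of_dvd (by norm_num) h
    omega
  have hval : ∀ m : Fin d, ∀ y : Site d (2 * Q), y = 0 → y m = 0 := fun m y hy => by rw [hy]; rfl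
  refine starLink_injective _ x hμ hμl ?_ ?_ ?_ ?_ ?_ ?_
  · intro j j' hjj'
    by_contra hne
    have hne' : μ j ≠ μ j' := fun h => hne (hμ h)
    have := congrFun hjj' (μ j)
    simp [cubicUnit_apply, hne'] at this
  · intro h; exact h1 (by simpa [cubicUnit_apply] using hval l _ h)
  · intro j h; exact h1 (by simpa [cubicUnit_apply] using hval (μ j) _ h)
  · intro j h
    have := congrFun h l
    simp [cubicUnit_apply, (hμl j).symm] at this
  · intro j h
    have := congrFun h l
    simp [cubicUnit_apply, (hμl j).symm] at this
  · intro j j' h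
    have := congrFun h (μ j)
    by_cases hjj : μ j = μ j'
    · simp [cubicUnit_apply, hjj] at this
      exact h2 this
    · simp [cubicUnit_apply, hjj] at this

variable {G : Type} [Group G] [TopologicalSpace G] [IsTopologicalGroup G] [CompactSpace G]
  [MeasurableSpace G] [BorelSpace G] [SecondCountableTopology G]

/-- **Link RP fails on the even torus at every `β < 0` for `(2n+1)`-dimensional representations of
determinant one with an `n`-star available.** `(ℤ/2Q)^d`, `Q ≥ 2`; axes: `k` (reflected), `l ≠ k`,
and distinct `μ_0, …, μ_{n-1} ∉ {k, l}` (so `n + 2 ≤ d`); `G` compact second countable,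
`ρ : G → M_N(ℂ)` continuous with `det ρ ≡ 1`, scalar commutant, `ρ ≢ 1`, `φ : Fin N ≃ Option (Fin n × Bool)`;
any `β < 0`: a bounded measurable observable of `{1 ≤ x_k ≤ Q}` with `∫ conj F(ΘU) · F(U) dμ_β < 0`,
`μ_β = wilsonMeasure ρ β`, `Θ` the reflection in `x_k = ½`. -/
theorem cubicTorus_linkRP_detOne_neg_odd (ρ : G →* Matrix (Fin N) (Fin N) ℂ) (hQ : 2 ≤ Q)
    {k l : Fin d} {μ : Fin n → Fin d} (hl : l ≠ k) (hμk : ∀ j, μ j ≠ k) (hμl : ∀ j, μ j ≠ l)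
    (hμ : Function.Injective μ) (φ : Fin N ≃ Option (Fin n × Bool)) (hρ : Continuous ρ)
    (hirr : TwistedSlab.HasScalarCommutant ρ) (hρ1 : ∃ g, ρ g ≠ 1) (hdet : ∀ g, (ρ g).det = 1)
    {β : ℝ} (hβ : β < 0) :
    ∃ F : GaugeConfig d (2 * Q) G → ℂ, Measurable F ∧ (∃ C : ℝ, ∀ U, ‖F U‖ ≤ C) ∧
      IsMidObservable (cubicUnit d (2 * Q)) Q (cubicAxisCoord d (2 * Q) k) F ∧
      ∫ U, conj (F (configMidReflect (cubicUnit d (2 * Q)) k (cubicAxisReflect d (2 * Q) k) U)) *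
        F U ∂(wilsonMeasure (d := d) (L := 2 * Q) ρ β) < 0 := by
  have hF := isSiteFrame_cubicTorus d hQ k
  have hx₁ := val_cubicAxisCoord_cubicUnit hQ k
  have hΩc := continuous_starVal ρ hρ φ
  refine ⟨netWitness ρ (cubicUnit d (2 * Q)) k Q (cubicAxisCoord d (2 * Q) k) β
      (starLink (cubicUnit d (2 * Q)) (cubicUnit d (2 * Q) k) l μ) (starVal ρ φ),
    (continuous_netWitness ρ (cubicUnit d (2 * Q)) k Q (cubicAxisCoord d (2 * Q) k) hρ β _ hΩc).measurable,
    exists_norm_netWitness_le ρ (cubicUnit d (2 * Q)) k Q (cubicAxisCoord d (2 * Q) k) hρ β _ hΩc,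
    hF.isMidObservable_netWitness ρ (hF.val_height_starLink hx₁ hl hμk)
      (starLink_snd_ne _ _ hl hμk) _ β, ?_⟩
  rw [← gibbs_cubicUnit_eq_wilsonMeasure ρ hρ β]
  exact hF.linkRP_star_neg_of_neg ρ hρ hirr hρ1 hdet hx₁ hl hμk φ
    (starLink_injective_cubicTorus hQ _ hμ hμl) hβ

/-- **`SU(2n+1)` LINK REFLECTION POSITIVITY FAILS ON THE EVEN TORUS AT EVERY `β < 0`** whenever the
torus has, besides the reflected axis `k` and the star axis `l`, `n ≥ 1` further distinct axes
(`n + 2 ≤ d`). `(ℤ/2Q)^d`, `Q ≥ 2`, `SU(N)` lattice Yang–Mills in the fundamental representation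
(`wilsonMeasure (fundamentalRep (Fin N)) β`, `N = 2n+1`), any `β < 0`: there is a bounded measurable
observable `F` of the closed half `{1 ≤ x_k ≤ Q}` with `∫ conj F(ΘU) · F(U) dμ_β(U) < 0`, `Θ` the
reflection in `x_k = ½`. The witness is the `N`-leg baryon star of the layer `x_k = 1` times
`exp(-β A)`. -/
theorem cubicTorus_linkRP_suN_neg_odd (hQ : 2 ≤ Q) {k l : Fin d} {μ : Fin n → Fin d} (hl : l ≠ k)
    (hμk : ∀ j, μ j ≠ k) (hμl : ∀ j, μ j ≠ l) (hμ : Function.Injective μ) (hn : 0 < n)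
    (φ : Fin N ≃ Option (Fin n × Bool)) {β : ℝ} (hβ : β < 0) :
    ∃ F : GaugeConfig d (2 * Q) (Matrix.specialUnitaryGroup (Fin N) ℂ) → ℂ, Measurable F ∧
      (∃ C : ℝ, ∀ U, ‖F U‖ ≤ C) ∧
      IsMidObservable (cubicUnit d (2 * Q)) Q (cubicAxisCoord d (2 * Q) k) F ∧
      ∫ U, conj (F (configMidReflect (cubicUnit d (2 * Q)) k (cubicAxisReflect d (2 * Q) k) U)) *
        F U ∂(wilsonMeasure (d := d) (L := 2 * Q) (fundamentalRep (Fin N)) β) < 0 := by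
  haveI : SecondCountableTopology (Matrix (Fin N) (Fin N) ℂ) :=
    inferInstanceAs (SecondCountableTopology (Fin N → Fin N → ℂ))
  haveI : SecondCountableTopology (Matrix.specialUnitaryGroup (Fin N) ℂ) :=
    Topology.IsEmbedding.subtypeVal.secondCountableTopology
  have hN : 2 ≤ N := by
    have hc := Fintype.card_congr φ
    simp only [Fintype.card_fin, Fintype.card_option, Fintype.card_prod, Fintype.card_bool] at hc
    omega
  exact cubicTorus_linkRP_detOne_neg_odd (fundamentalRep (Fin N)) hQ hl hμk hμl hμ φ
    (continuous_fundamentalRep (Fin N)) hasScalarCommutant_fundamentalRep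
    (exists_fundamentalRep_ne_one hN) (fun g => (Matrix.mem_specialUnitaryGroup_iff.1 g.2).2) hβ

/-- **Corollary: the link RP statement of `cubicTorus_linkRP_suN` for `SU(2n+1)` is FALSE at every
`β < 0`** (`(ℤ/2Q)^d`, `Q ≥ 2`, axes `k, l, μ_0, …, μ_{n-1}` distinct, `n ≥ 1`). -/
theorem not_cubicTorus_linkRP_suN_odd (hQ : 2 ≤ Q) {k l : Fin d} {μ : Fin n → Fin d} (hl : l ≠ k)
    (hμk : ∀ j, μ j ≠ k) (hμl : ∀ j, μ j ≠ l) (hμ : Function.Injective μ) (hn : 0 < n)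
    (φ : Fin N ≃ Option (Fin n × Bool)) {β : ℝ} (hβ : β < 0) :
    ¬ ∀ F : GaugeConfig d (2 * Q) (Matrix.specialUnitaryGroup (Fin N) ℂ) → ℂ, Measurable F →
        (∃ C : ℝ, ∀ U, ‖F U‖ ≤ C) →
        IsMidObservable (cubicUnit d (2 * Q)) Q (cubicAxisCoord d (2 * Q) k) F →
        0 ≤ ∫ U, conj (F (configMidReflect (cubicUnit d (2 * Q)) k (cubicAxisReflect d (2 * Q) k) U)) *
          F U ∂(wilsonMeasure (d := d) (L := 2 * Q) (fundamentalRep (Fin N)) β) := by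
  intro hall
  obtain ⟨F, hFm, hFb, hFo, hneg⟩ := cubicTorus_linkRP_suN_neg_odd hQ hl hμk hμl hμ hn φ hβ
  exact absurd (hall F hFm hFb hFo) (not_le_of_gt hneg)

/-- **The threshold is exactly `β = 0`**: for `SU(2n+1)` on the even torus `(ℤ/2Q)^d`, `Q ≥ 2`, with
axes `k, l, μ_0, …, μ_{n-1}` distinct (`n ≥ 1`), closed-half link reflection positivity along `k`
holds for all bounded measurable half observables if and only if `0 ≤ β`. -/
theorem cubicTorus_linkRP_suN_odd_iff (hQ : 2 ≤ Q) {k l : Fin d} {μ : Fin n → Fin d} (hl : l ≠ k)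
    (hμk : ∀ j, μ j ≠ k) (hμl : ∀ j, μ j ≠ l) (hμ : Function.Injective μ) (hn : 0 < n)
    (φ : Fin N ≃ Option (Fin n × Bool)) (β : ℝ) :
    (∀ F : GaugeConfig d (2 * Q) (Matrix.specialUnitaryGroup (Fin N) ℂ) → ℂ, Measurable F →
        (∃ C : ℝ, ∀ U, ‖F U‖ ≤ C) →
        IsMidObservable (cubicUnit d (2 * Q)) Q (cubicAxisCoord d (2 * Q) k) F →
        0 ≤ ∫ U, conj (F (configMidReflect (cubicUnit d (2 * Q)) k (cubicAxisReflect d (2 * Q) k) U)) *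
          F U ∂(wilsonMeasure (d := d) (L := 2 * Q) (fundamentalRep (Fin N)) β)) ↔ 0 ≤ β := by
  constructor
  · intro hall
    by_contra hβ
    exact not_cubicTorus_linkRP_suN_odd hQ hl hμk hμl hμ hn φ (not_le.1 hβ) hall
  · intro hβ F hFm hFb hFo
    exact cubicTorus_linkRP_suN hQ k hβ F hFm hFb hFo

end Torus

/-! ## In terms of `N` and `d` only: `N` odd, `3 ≤ N ≤ 2d - 3` -/

section Rank

variable {d Q N : ℕ} [NeZero Q]

omit [NeZero Q] in
/-- **Room for the star**: if `n + 2 ≤ d` there are, besides any given axis `k`, an axis `l ≠ k`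
and `n` further distinct axes `μ_j ∉ {k, l}`. [folklore] -/
theorem exists_star_axes {n : ℕ} (k : Fin d) (hnd : n + 2 ≤ d) :
    ∃ (l : Fin d) (μ : Fin n → Fin d),
      l ≠ k ∧ (∀ j, μ j ≠ k) ∧ (∀ j, μ j ≠ l) ∧ Function.Injective μ := by
  classical
  have hs : n + 1 ≤ (Finset.univ.erase k).card := by
    rw [Finset.card_erase_of_mem (Finset.mem_univ k), Finset.card_univ, Fintype.card_fin]
    omega
  let ψ : Fin (Finset.univ.erase k).card ≃ {x // x ∈ Finset.univ.erase k} :=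
    (Finset.univ.erase k).equivFin.symm
  let ι : Fin (n + 1) → Fin d := fun i => (ψ (Fin.castLE hs i)).1
  have hι : Function.Injective ι := fun i i' hii' =>
    Fin.castLE_injective hs (ψ.injective (Subtype.ext hii'))
  have hιk : ∀ i, ι i ≠ k := fun i => Finset.ne_of_mem_erase (ψ (Fin.castLE hs i)).2
  refine ⟨ι (Fin.last n), fun j => ι (Fin.castSucc j), hιk _, fun j => hιk _, fun j hj => ?_,
    fun j j' hjj' => Fin.castSucc_injective n (hι hjj')⟩
  exact (Fin.castSucc_lt_last j).ne (hι hj)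

omit [NeZero Q] in
/-- For `N` odd, a bijection `Fin N ≃ Option (Fin (N/2) × Bool)` (the `ε`-indices and the legs of
the `(N/2)`-star). [folklore] -/
theorem nonempty_equiv_starLegs (hN : Odd N) : Nonempty (Fin N ≃ Option (Fin (N / 2) × Bool)) := by
  have h2 := Nat.odd_iff.1 hN
  refine ⟨Fintype.equivOfCardEq ?_⟩
  simp only [Fintype.card_fin, Fintype.card_option, Fintype.card_prod, Fintype.card_bool]
  omega

/-- **`SU(N)` LINK REFLECTION POSITIVITY FAILS ON THE EVEN TORUS AT EVERY `β < 0` FOR EVERY ODD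
`N` WITH `3 ≤ N ≤ 2d - 3`.** On `(ℤ/2Q)^d`, `Q ≥ 2`, along ANY axis `k`, for `SU(N)` lattice
Yang–Mills in the fundamental representation with `N` odd, `3 ≤ N` and `N + 3 ≤ 2d` (e.g. `SU(3)` in
`d ≥ 3`, `SU(5)` in `d ≥ 4`), and any `β < 0`: there is a bounded measurable observable `F` of the
closed half `{1 ≤ x_k ≤ Q}` with `∫ conj F(ΘU) · F(U) dμ_β(U) < 0`, `Θ` the reflection in `x_k = ½`. -/
theorem cubicTorus_linkRP_suN_neg_of_odd (hQ : 2 ≤ Q) (k : Fin d) (hN : Odd N) (h3 : 3 ≤ N)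
    (hNd : N + 3 ≤ 2 * d) {β : ℝ} (hβ : β < 0) :
    ∃ F : GaugeConfig d (2 * Q) (Matrix.specialUnitaryGroup (Fin N) ℂ) → ℂ, Measurable F ∧
      (∃ C : ℝ, ∀ U, ‖F U‖ ≤ C) ∧
      IsMidObservable (cubicUnit d (2 * Q)) Q (cubicAxisCoord d (2 * Q) k) F ∧
      ∫ U, conj (F (configMidReflect (cubicUnit d (2 * Q)) k (cubicAxisReflect d (2 * Q) k) U)) *
        F U ∂(wilsonMeasure (d := d) (L := 2 * Q) (fundamentalRep (Fin N)) β) < 0 := by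
  have h2 := Nat.odd_iff.1 hN
  obtain ⟨l, μ, hl, hμk, hμl, hμ⟩ := exists_star_axes (n := N / 2) k (by omega)
  obtain ⟨φ⟩ := nonempty_equiv_starLegs hN
  exact cubicTorus_linkRP_suN_neg_odd hQ hl hμk hμl hμ (by omega) φ hβ

/-- **Corollary: the link RP statement of `cubicTorus_linkRP_suN` is FALSE at every `β < 0` for
every odd `N` with `3 ≤ N ≤ 2d - 3`** (`(ℤ/2Q)^d`, `Q ≥ 2`, any axis). -/
theorem not_cubicTorus_linkRP_suN_of_odd (hQ : 2 ≤ Q) (k : Fin d) (hN : Odd N) (h3 : 3 ≤ N)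
    (hNd : N + 3 ≤ 2 * d) {β : ℝ} (hβ : β < 0) :
    ¬ ∀ F : GaugeConfig d (2 * Q) (Matrix.specialUnitaryGroup (Fin N) ℂ) → ℂ, Measurable F →
        (∃ C : ℝ, ∀ U, ‖F U‖ ≤ C) →
        IsMidObservable (cubicUnit d (2 * Q)) Q (cubicAxisCoord d (2 * Q) k) F →
        0 ≤ ∫ U, conj (F (configMidReflect (cubicUnit d (2 * Q)) k (cubicAxisReflect d (2 * Q) k) U)) *
          F U ∂(wilsonMeasure (d := d) (L := 2 * Q) (fundamentalRep (Fin N)) β) := by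
  intro hall
  obtain ⟨F, hFm, hFb, hFo, hneg⟩ := cubicTorus_linkRP_suN_neg_of_odd hQ k hN h3 hNd hβ
  exact absurd (hall F hFm hFb hFo) (not_le_of_gt hneg)

/-- **THE THRESHOLD IS EXACTLY `β = 0` FOR EVERY ODD `N` WITH `3 ≤ N ≤ 2d - 3`.** On the even torus
`(ℤ/2Q)^d`, `Q ≥ 2`, along any axis `k`, closed-half link reflection positivity of `SU(N)` lattice
Yang–Mills (`N` odd, `3 ≤ N`, `N + 3 ≤ 2d`) holds for all bounded measurable half observables if and
only if `0 ≤ β`. (For `SU(2)`, `SU(2n)`, `U(N)` it holds at every real `β`: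
`CubicTorusLinkRPAnyBeta.lean`; in two dimensions at every `β` for every `G`:
`CubicTorusLinkRPTwoDim.lean`.) -/
theorem cubicTorus_linkRP_suN_iff_of_odd (hQ : 2 ≤ Q) (k : Fin d) (hN : Odd N) (h3 : 3 ≤ N)
    (hNd : N + 3 ≤ 2 * d) (β : ℝ) :
    (∀ F : GaugeConfig d (2 * Q) (Matrix.specialUnitaryGroup (Fin N) ℂ) → ℂ, Measurable F →
        (∃ C : ℝ, ∀ U, ‖F U‖ ≤ C) →
        IsMidObservable (cubicUnit d (2 * Q)) Q (cubicAxisCoord d (2 * Q) k) F →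
        0 ≤ ∫ U, conj (F (configMidReflect (cubicUnit d (2 * Q)) k (cubicAxisReflect d (2 * Q) k) U)) *
          F U ∂(wilsonMeasure (d := d) (L := 2 * Q) (fundamentalRep (Fin N)) β)) ↔ 0 ≤ β := by
  constructor
  · intro hall
    by_contra hβ
    exact not_cubicTorus_linkRP_suN_of_odd hQ k hN h3 hNd (not_le.1 hβ) hall
  · intro hβ F hFm hFb hFo
    exact cubicTorus_linkRP_suN hQ k hβ F hFm hFb hFo

end Rank

end TiltedRP

end Summit.QuantumFields.GaugeBoot

end
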